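import Literature.Barriers.PneNP.PerfectMatchingPsdLiftLowerBounds
import Literature.Barriers.PneNP.ExtendedFormulationCalculus
import Mathlib.Analysis.Convex.Birkhoff
import Mathlib.Data.Sym.Sym2.Order
import HarnessLib

/-!
# `xc(P_PM(K_n)) ≤ poly(n) · 2^{n/2}`: the perfect matching polytope is the convex hull of
# `2^{n/2}·poly(n)` bipartite perfect matching polytopes (Faenza–Fiorini–Grappe–Tiwary; Rothvoß §1)

T. Rothvoß, *The matching polytope has exponential extension complexity*, J. ACM 64 (2017) =
arXiv:1311.2369 [Rothvoss2017], §1 (PDF p. 4, L26–30), verbatim: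

> "Moreover, the best known upper bound on the extension complexity in general graphs is
> `poly(n) · 2^{n/2}` [Faenza–Fiorini–Grappe–Tiwary, ISCO 2012], which follows from the fact that
> `poly(n) · 2^{n/2}` many randomly taken complete bipartite graphs cover all matchings and that the
> convex hull of the union of polytopes can be described with a few extra inequalities [Balas 1985]."

Y. Faenza, S. Fiorini, R. Grappe, H. R. Tiwary, *Extended formulations, nonnegative factorizations, and
randomized communication protocols*, ISCO 2012 / Math. Program. 153 (2015), arXiv:1105.4127
[FaenzaFioriniGrappeTiwary2015] (held text `paper:arxiv-1105.4127`), §3 before Example 3 (p0009 L1),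
verbatim: "one can cover the complete graph `K^n` with `k = O(2^{n/2} poly(n))` balanced complete bipartite
graphs `G_1, …, G_k` in such a way that every perfect matching of `K^n` is a perfect matching of at least one
of the `G_i`'s. See Lemma 12 and its proof in the appendix."; Appendix, **Lemma 12** (p0014 L12),
verbatim: "Let `n` be an even positive integer. There exists a collection of `k = O(2^{n/2} √n ln n)`
subsets `X_1, …, X_k` of size `n/2` of `[n]` such that for every perfect matching `M` of `K^n` at least
one of the subsets `X_i` is compatible with `M`, that is, all the edges of `M` have one end in `X_i` and
the other in `X̄_i = [n] ∖ X_i`." (printed proof: fractional set cover of value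
`2^{-n/2}·C(n,n/2) ≤ 2^{n/2}/√n` — "each given perfect matching `M` is compatible with exactly `2^{n/2}`
subsets `X`" — and the greedy algorithm); Example 3 (p0009 L4–13): "The resulting extension has size at
most `2^{(1/2+ε)n}`".

## What is proved (no named facts; every statement a theorem)

In the tree's currencies (`pmPolytope n ⊆ ℝ^{E(K_n)}` = `conv{χ^M}`, `IsPMOn`, `cutCount`,
`HasEFOfSize`, `HasPointedEFOfSize` / `pointedSet` = the pointed (affine V-type) formulations on which
the tree's Balas bound `HasPointedEFOfSize.convexHull_union` — `xc(P ⊔ Q) ≤ xc(P) + xc(Q) + 2` — runs):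

* `IsCompatible X M` — "all the edges of `M` have one end in `X` and the other in `X̄`" (Lemma 12);
  `IsCompatible.card_eq` (a compatible `X` has `|X| = |M| = n/2`).
* **Lemma 12, the count `2^{n/2}`** — `MatchingBipartiteCover.two_pow_card_le_card_filter`: every
  perfect matching `M` of `K_n` is compatible with at least `2^{|M|}` sets `X` (choose one endpoint of
  each edge: the sets `side M T`, `T ⊆ M`, are pairwise distinct and compatible).
* **Lemma 12, the cover** — `exists_compatible_cover` /
  `FaenzaFioriniGrappeTiwary2015_lemma12`: for `n = 2m` there is a family of at most
  `2^m · (m(2m+1) + 1)` (`≤ 2^{n/2} · n²` once `n ≥ 2`) subsets of size `m`, some member of which is compatible with any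
  given perfect matching.  Proved by the union bound over independent uniform choices, in exact finite
  counting form (`exists_hitting_family`: if every element of `P` is good for `≥ g` of the `b ≤ g²`
  candidate sets and `|P| < 2^s`, some `g·s`-tuple of candidates hits every element — the estimate
  `|P|·(b−g)^{gs} < b^{gs}` is `two_pow_le_one_add_pow` / `card_mul_pow_sub_lt_pow`, Bernoulli), with
  the crude bound `#PM(K_n) ≤ 2^{|E(K_n)| + n} < 2^{m(2m+1)+1}`.
  -- TODO(sharper count): the printed `k = O(2^{n/2} √n ln n)` uses `C(n,n/2) ≤ 2^{n/2}·2^{n/2}/√n` and the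
  -- greedy set-cover ratio `1 + ln #PM(K_n)`; only `poly(n)·2^{n/2}` (Rothvoß's form) is formalised.
* **The bipartite pieces (Birkhoff–von Neumann)** — for `|X| = |X̄|`,
  `convexHull_bipGens_eq_pointedSet`: `conv{χ^M : M compatible with X}` (the perfect matching polytope of
  the balanced complete bipartite graph `K_{X,X̄}` inside `ℝ^{E(K_n)}`) is the pointed formulation
  "`x_{i φ(j)} = y_{ij}` (`i, j ∈ X`, `φ : X ≃ X̄`), `x = 0` elsewhere, `y ≥ 0` doubly stochastic", via
  Mathlib's `exists_eq_sum_perm_of_mem_doublyStochastic`; hence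
  `hasPointedEFOfSize_convexHull_bipGens`: it has a pointed EF of size `|X|²`.
* **Balas over the cover** — `hasPointedEFOfSize_convexHull_biUnion` (a union of `k` pieces of pointed
  size `c` costs `k·(c+2)`), `pmPolytope_eq_convexHull_biUnion` (a compatible cover exhibits `P_PM(K_n)`
  as the convex hull of the union of its pieces).
* **The bound** — `hasEFOfSize_pmPolytope_bipartiteCover`:
  `xc(P_PM(K_{2m})) ≤ 2^m · (m(2m+1)+1) · (m²+2)`; `hasEFOfSize_pmPolytope_halfExp`:
  **`xc(P_PM(K_n)) ≤ n⁴ · 2^{n/2}`** for every even `n ≥ 2`; with Rothvoß's Theorem 1 (tree theorem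
  `Rothvoss2017_thm1`) the window `Rothvoss2017_thm1_theta_halfExp`:
  `2^{cn} ≤ xc(P_PM(K_n)) ≤ n⁴·2^{n/2}` eventually on even `n` (sharpening the trivial `2^{n+1}` of
  `Rothvoss2017_thm1_theta`); psd twin `hasPsdLift_pmPolytope_halfExp` (a psd lift of size
  `n⁴·2^{n/2} + 1`, via `hasPsdLift_pmPolytope_of_hasEFOfSize`).

* **Slack-matrix reading (appended section)** — `hasNonnegFactorization_pmOddCutSlack_halfExp`,
  `hasPsdFactorization_pmOddCutSlack_halfExp` (+ `pmFullSlack` twins): `rk_psd(S_n) ≤ rk₊(S_n) ≤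
  n⁴·2^{n/2} + 1` for the odd-cut slack matrix `S_n = pmOddCutSlack n` (Yannakakis), i.e. the kernel
  window `C(n/2+1, 2) − 1 ≤ rk_psd(S_n) ≤ n⁴·2^{n/2} + 1`.

Design: Rothvoß's one-sentence proof (cover + Balas) is followed literally; FFGT's own route (Example 3:
a randomized protocol of complexity `(1/2+ε)n` + their Theorem 2, tree theorem
`Literature.Computability.Complexity.FaenzaFioriniGrappeTiwary2015_ef_of_protocol`) gives the same order
and is not repeated here.  The Birkhoff step is Mathlib's theorem transported along an explicit
coordinate embedding (no second proof of Birkhoff–von Neumann).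

Stature (cell pnp-psdrank line 1): instrument/catalogue — an UPPER bound on LINEAR extension complexity;
nothing here is a lower bound, nothing concerns psd rank beyond the trivial lift corollary, and nothing
bears on P versus NP.  WHAT THIS IS NOT: not FFGT's sharper piece count `O(2^{n/2}√n ln n)`; not a
statement about the matching polytope `P_M(K_n)` of all matchings (for which Edmonds' description already
gives `2^{n+1}`, tree theorem `hasEFOfSize_edmondsPolytope_top_two_pow`).

## References

* [FaenzaFioriniGrappeTiwary2015] Y. Faenza, S. Fiorini, R. Grappe, H. R. Tiwary, *Extended
  formulations, nonnegative factorizations, and randomized communication protocols*, Math. Program. 153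
  (2015) 75–94; ISCO 2012, LNCS 7422, 129–140; arXiv:1105.4127 — §3 Example 3 (p0009), Appendix
  Lemma 12 (p0014 L12–26).
* [Rothvoss2017] T. Rothvoß, *The matching polytope has exponential extension complexity*, J. ACM 64
  (2017) Art. 41; arXiv:1311.2369 — §1 (PDF p. 4, L26–30), Thm. 1.
* [HrubesYehudayoff2021] P. Hrubeš, A. Yehudayoff, *Shadows of Newton polytopes*, CCC 2021 — Lemma 34
  (Balas' union bound in the form the tree proves, `ExtendedFormulationCalculus.lean`).
* [KorteVygen2018] B. Korte, J. Vygen, *Combinatorial Optimization: Theory and Algorithms*, 6th ed.,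
  Springer 2018 — §11.1, Thm. 11.4 (the fractional perfect matching polytope of a bipartite graph is
  integral) and Cor. 11.5 (Birkhoff 1946 / von Neumann 1953; held scan p. 265); Mathlib:
  `doublyStochastic_eq_convexHull_permMatrix`, `exists_eq_sum_perm_of_mem_doublyStochastic`.
* E. Balas, *Disjunctive programming and a hierarchy of relaxations for discrete optimization problems*,
  SIAM J. Algebraic Discrete Methods 6 (1985) 466–486 (as cited by Rothvoß, loc. cit.).

Private lemmas tagged `[folklore]` are plumbing (order facts on `Sym2`, the Bernoulli estimate, entries
of `A y`, `B y` and of permutation matrices); every public statement carries its printed locator.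
-/

noncomputable section

open Finset Matrix Filter

namespace Literature.Barriers.PneNP

variable {n : ℕ}

/-! ### Compatibility of a vertex set with a perfect matching -/

/-- **`X` is compatible with `M`**: "all the edges of `M` have one end in `X` and the other in
`X̄ = [n] ∖ X`", i.e. every edge of `M` has exactly one endpoint in `X` (`cutCount X e = 1`).
(An `abbrev`, so that `Finset.filter` finds the decidability of the bounded quantifier.)
[cite: FaenzaFioriniGrappeTiwary2015, Lemma 12 (Appendix; arXiv p. 14)] -/
abbrev IsCompatible (X : Finset (Fin n)) (M : Finset (Sym2 (Fin n))) : Prop :=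
  ∀ e ∈ M, cutCount X e = 1

/-- A set compatible with a perfect matching `M` of `K_n` meets every edge of `M` exactly once, so it has
exactly `|M|` elements ("subsets `X_i` of size `n/2`").
[cite: FaenzaFioriniGrappeTiwary2015, Lemma 12 (Appendix; arXiv p. 14)] -/
theorem IsCompatible.card_eq {X : Finset (Fin n)} {M : Finset (Sym2 (Fin n))}
    (hM : IsPMOn Finset.univ M) (hX : IsCompatible X M) : X.card = M.card := by
  rw [hM.card_eq_sum_cutCount (subset_univ X), sum_congr rfl fun e he => hX e he]
  simp

/-- A perfect matching of `K_n` has `n/2` edges: `2|M| = n`. [folklore] -/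
private theorem IsPMOn.two_mul_card_eq {M : Finset (Sym2 (Fin n))} (hM : IsPMOn Finset.univ M) :
    2 * M.card = n := by
  have h := hM.card_eq_sum_cutCount (subset_univ (Finset.univ : Finset (Fin n)))
  have h2 : ∀ e ∈ M, cutCount (Finset.univ : Finset (Fin n)) e = 2 := fun e _ => by
    induction e using Sym2.ind with
    | h a b => simp [cutCount_mk]
  rw [sum_congr rfl h2, sum_const, smul_eq_mul, card_univ, Fintype.card_fin] at h
  omega

/-! ### Lemma 12, first half: every perfect matching is compatible with `2^{n/2}` sets
(choose one endpoint of each of its edges) -/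

namespace MatchingBipartiteCover

/-- The smaller endpoint of a pair lies on it. [folklore] -/
private theorem inf_mem (e : Sym2 (Fin n)) : e.inf ∈ e := by
  induction e using Sym2.ind with
  | h a b =>
    rcases le_total a b with h | h
    · simp [inf_of_le_left h]
    · simp [inf_of_le_right h]

/-- The larger endpoint of a pair lies on it. [folklore] -/
private theorem sup_mem (e : Sym2 (Fin n)) : e.sup ∈ e := by
  induction e using Sym2.ind with
  | h a b =>
    rcases le_total a b with h | h
    · simp [sup_of_le_right h]
    · simp [sup_of_le_left h]

/-- A non-loop pair has two distinct endpoints. [folklore] -/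
private theorem inf_ne_sup {e : Sym2 (Fin n)} (he : ¬e.IsDiag) : e.inf ≠ e.sup := by
  induction e using Sym2.ind with
  | h a b =>
    rw [Sym2.mk_isDiag_iff] at he
    intro h
    rcases le_total a b with hab | hab
    · rw [Sym2.inf_mk, Sym2.sup_mk, inf_of_le_left hab, sup_of_le_right hab] at h
      exact he h
    · rw [Sym2.inf_mk, Sym2.sup_mk, inf_of_le_right hab, sup_of_le_left hab] at h
      exact he h.symm

/-- The endpoint of `e` chosen by `T`: the larger one if `e ∈ T`, the smaller one otherwise ("choose for
each edge which of its ends goes into `X`"). [cite: FaenzaFioriniGrappeTiwary2015, Lemma 12 (Appendix; arXiv p. 14: "compatible with exactly `2^{n/2}` subsets")] -/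
def pick (T : Finset (Sym2 (Fin n))) (e : Sym2 (Fin n)) : Fin n :=
  if e ∈ T then e.sup else e.inf

/-- The chosen endpoint lies on the edge. [folklore] -/
private theorem pick_mem (T : Finset (Sym2 (Fin n))) (e : Sym2 (Fin n)) : pick T e ∈ e := by
  unfold pick
  split_ifs
  · exact sup_mem e
  · exact inf_mem e

/-- The vertex set selected by `T ⊆ M`: one endpoint of each edge of `M`, the larger one exactly on the
edges of `T`. [cite: FaenzaFioriniGrappeTiwary2015, Lemma 12 (Appendix; arXiv p. 14)] -/
def side (M T : Finset (Sym2 (Fin n))) : Finset (Fin n) :=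
  M.image (pick T)

/-- Each selected set is compatible with the matching: an edge `e ∈ M` contains its chosen endpoint, and
its other endpoint is chosen by no edge (edges of a matching are disjoint).
[cite: FaenzaFioriniGrappeTiwary2015, Lemma 12 (Appendix; arXiv p. 14)] -/
theorem side_compatible {M : Finset (Sym2 (Fin n))} (hM : IsPMOn Finset.univ M)
    (T : Finset (Sym2 (Fin n))) : IsCompatible (side M T) M := by
  intro e he
  have hd : ¬e.IsDiag := hM.not_isDiag he
  have ha : pick T e ∈ e := pick_mem T e
  have heq : s(pick T e, Sym2.Mem.other ha) = e := Sym2.other_spec ha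
  have hba : Sym2.Mem.other ha ≠ pick T e := Sym2.other_ne hd ha
  have hb : Sym2.Mem.other ha ∈ e := Sym2.other_mem ha
  have haS : pick T e ∈ side M T := mem_image.2 ⟨e, he, rfl⟩
  have hbS : Sym2.Mem.other ha ∉ side M T := by
    intro hbS
    obtain ⟨e', he', hpe'⟩ := mem_image.1 hbS
    have hbe' : Sym2.Mem.other ha ∈ e' := hpe' ▸ pick_mem T e'
    have hee : e' = e := hM.unique he' he hbe' hb
    rw [hee] at hpe'
    exact hba hpe'.symm
  rw [← heq, cutCount_mk, if_pos haS, if_neg hbS]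

/-- Membership of an edge of `M` in `T` is read off the selected set: `e ∈ T` iff the larger endpoint of
`e` was selected. [cite: FaenzaFioriniGrappeTiwary2015, Lemma 12 (Appendix; arXiv p. 14)] -/
theorem mem_iff_sup_mem_side {M : Finset (Sym2 (Fin n))} (hM : IsPMOn Finset.univ M)
    (T : Finset (Sym2 (Fin n))) {e : Sym2 (Fin n)} (he : e ∈ M) : e ∈ T ↔ e.sup ∈ side M T := by
  constructor
  · intro heT
    exact mem_image.2 ⟨e, he, by simp [pick, heT]⟩
  · intro h
    obtain ⟨e', he', hpe'⟩ := mem_image.1 h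
    have h1 : e.sup ∈ e' := hpe' ▸ pick_mem T e'
    have h2 : e' = e := hM.unique he' he h1 (sup_mem e)
    subst h2
    by_contra heT
    simp only [pick, if_neg heT] at hpe'
    exact inf_ne_sup (hM.not_isDiag he) hpe'

/-- Distinct subsets of `M` select distinct vertex sets. [cite: FaenzaFioriniGrappeTiwary2015, Lemma 12 (Appendix; arXiv p. 14)] -/
theorem side_injOn {M : Finset (Sym2 (Fin n))} (hM : IsPMOn Finset.univ M) :
    Set.InjOn (side M) (M.powerset : Set (Finset (Sym2 (Fin n)))) := by
  intro T hT T' hT' h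
  rw [mem_coe, mem_powerset] at hT hT'
  ext e
  constructor
  · intro heT
    have he : e ∈ M := hT heT
    rw [mem_iff_sup_mem_side hM T' he, ← h]
    exact (mem_iff_sup_mem_side hM T he).1 heT
  · intro heT'
    have he : e ∈ M := hT' heT'
    rw [mem_iff_sup_mem_side hM T he, h]
    exact (mem_iff_sup_mem_side hM T' he).1 heT'

/-- **"Each given perfect matching `M` is compatible with exactly `2^{n/2}` subsets `X`"** — the
inequality `≥ 2^{|M|}` that the covering argument uses: any family `B` containing all the selected sets
`side M T` (`T ⊆ M`) has at least `2^{|M|}` members compatible with `M`.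
[cite: FaenzaFioriniGrappeTiwary2015, Lemma 12 (Appendix; arXiv p. 14)] -/
theorem two_pow_card_le_card_filter {M : Finset (Sym2 (Fin n))} (hM : IsPMOn Finset.univ M)
    (B : Finset (Finset (Fin n))) (hB : ∀ T ⊆ M, side M T ∈ B) :
    2 ^ M.card ≤ (B.filter fun X => IsCompatible X M).card := by
  rw [← card_powerset]
  refine card_le_card_of_injOn (side M) ?_ (side_injOn hM)
  intro T hT
  rw [mem_coe, mem_powerset] at hT
  rw [mem_coe, mem_filter]
  exact ⟨hB T hT, side_compatible hM T⟩

/-- A selected set has `|M|` elements. [cite: FaenzaFioriniGrappeTiwary2015, Lemma 12 (Appendix; arXiv p. 14)] -/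
theorem card_side {M : Finset (Sym2 (Fin n))} (hM : IsPMOn Finset.univ M)
    (T : Finset (Sym2 (Fin n))) : (side M T).card = M.card :=
  (side_compatible hM T).card_eq hM

end MatchingBipartiteCover

/-! ### Lemma 12, second half: the union bound -/

/-- Bernoulli: if `1 ≤ g ≤ b ≤ g²` then `2 ≤ (1 + g/b)^g`, hence `2^s ≤ (1 + g/b)^{g·s}`. [folklore] -/
private theorem two_pow_le_one_add_pow (b g : ℝ) (gn s : ℕ) (hgn : (gn : ℝ) = g) (hg : 1 ≤ g) (hgb : g ≤ b)
    (hb : b ≤ g * g) : (2 : ℝ) ^ s ≤ (1 + g / b) ^ (gn * s) := by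
  have hb0 : 0 < b := by linarith
  have hx0 : 0 ≤ g / b := div_nonneg (by linarith) hb0.le
  rw [pow_mul]
  refine pow_le_pow_left₀ (by norm_num) ?_ s
  have h1 : (1 : ℝ) ≤ g * (g / b) := by
    rw [mul_div_assoc', one_le_div hb0]
    exact hb
  calc (2 : ℝ) = 1 + 1 := by norm_num
    _ ≤ 1 + (gn : ℝ) * (g / b) := by rw [hgn]; linarith
    _ ≤ (1 + g / b) ^ gn := one_add_mul_le_pow (by linarith) gn

/-- **The union-bound estimate** (real form): if `1 ≤ g ≤ b ≤ g²` and `N < 2^s` then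
`N · (b − g)^{g s} < b^{g s}` — i.e. `N · (1 − g/b)^{gs} < 1`, from `(1 − x)^t (1 + x)^t ≤ 1` and
`(1 + x)^t ≥ 2^s > N`. [folklore] -/
private theorem card_mul_pow_sub_lt_pow_real (N b g : ℝ) (gn s : ℕ) (hgn : (gn : ℝ) = g) (hg : 1 ≤ g)
    (hgb : g ≤ b) (hb : b ≤ g * g) (hN : N < (2 : ℝ) ^ s) :
    N * (b - g) ^ (gn * s) < b ^ (gn * s) := by
  have hb0 : 0 < b := by linarith
  set x : ℝ := g / b with hx
  have hx0 : 0 ≤ x := div_nonneg (by linarith) hb0.le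
  have hx1 : x ≤ 1 := (div_le_one hb0).2 hgb
  have hbg : b - g = b * (1 - x) := by
    rw [hx]
    field_simp
  have key : N < (1 + x) ^ (gn * s) :=
    lt_of_lt_of_le hN (two_pow_le_one_add_pow b g gn s hgn hg hgb hb)
  have hsmall : N * (1 - x) ^ (gn * s) < 1 := by
    rcases eq_or_lt_of_le (pow_nonneg (by linarith : (0 : ℝ) ≤ 1 - x) (gn * s)) with h0 | hpos
    · rw [← h0, mul_zero]
      exact zero_lt_one
    · calc N * (1 - x) ^ (gn * s) < (1 + x) ^ (gn * s) * (1 - x) ^ (gn * s) :=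
            mul_lt_mul_of_pos_right key hpos
        _ = (1 - x ^ 2) ^ (gn * s) := by rw [← mul_pow]; ring
        _ ≤ 1 := pow_le_one₀ (by nlinarith) (by nlinarith)
  have hbt : 0 < b ^ (gn * s) := pow_pos hb0 _
  calc N * (b - g) ^ (gn * s) = b ^ (gn * s) * (N * (1 - x) ^ (gn * s)) := by
        rw [hbg, mul_pow]; ring
    _ < b ^ (gn * s) * 1 := mul_lt_mul_of_pos_left hsmall hbt
    _ = b ^ (gn * s) := mul_one _

/-- The union-bound estimate in `ℕ`: `1 ≤ g ≤ b ≤ g²`, `N < 2^s` ⟹ `N · (b − g)^{g s} < b^{g s}`.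
[folklore] -/
private theorem card_mul_pow_sub_lt_pow (N b g s : ℕ) (hg : 1 ≤ g) (hgb : g ≤ b) (hb : b ≤ g * g)
    (hN : N < 2 ^ s) : N * (b - g) ^ (g * s) < b ^ (g * s) := by
  have h := card_mul_pow_sub_lt_pow_real (N : ℝ) (b : ℝ) (g : ℝ) g s rfl (by exact_mod_cast hg)
    (by exact_mod_cast hgb) (by exact_mod_cast hb) (by exact_mod_cast hN)
  rw [← Nat.cast_sub hgb] at h
  exact_mod_cast h

/-- **The covering argument of Lemma 12, abstract form** (union bound over independent uniform choices,
as exact counting).  Let every `a ∈ P` be "good" for at least `g ≥ 1` members of a family `B` of size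
`g ≤ |B| ≤ g²`, and let `|P| < 2^s`.  Then some sub-family of at most `g·s` members of `B` contains a
good member for every `a ∈ P`: among the `|B|^{gs}` tuples `Fin (g s) → B`, those missing some `a`
number at most `|P|·(|B| − g)^{gs} < |B|^{gs}`. [cite: FaenzaFioriniGrappeTiwary2015, Lemma 12 (Appendix; arXiv p. 14, proof)] -/
theorem exists_hitting_family {α β : Type*} [DecidableEq β] (P : Finset α) (B : Finset β)
    (good : α → Finset β) (hgood : ∀ a ∈ P, good a ⊆ B) (g s : ℕ) (hg : 1 ≤ g) (hgb : g ≤ B.card)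
    (hb : B.card ≤ g * g) (hcard : ∀ a ∈ P, g ≤ (good a).card) (hN : P.card < 2 ^ s) :
    ∃ 𝒳 : Finset β, 𝒳 ⊆ B ∧ 𝒳.card ≤ g * s ∧ ∀ a ∈ P, ∃ X ∈ 𝒳, X ∈ good a := by
  classical
  set t : ℕ := g * s with ht
  set Ω : Finset (Fin t → β) := Fintype.piFinset fun _ => B with hΩ
  set bad : α → Finset (Fin t → β) := fun a => Fintype.piFinset fun _ => B \ good a with hbad_def
  have hΩcard : Ω.card = B.card ^ t := Fintype.card_piFinset_const _ _
  have hbad : ∀ a ∈ P, (bad a).card ≤ (B.card - g) ^ t := fun a ha => by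
    rw [hbad_def, Fintype.card_piFinset_const, card_sdiff_of_subset (hgood a ha)]
    exact Nat.pow_le_pow_left (Nat.sub_le_sub_left (hcard a ha) _) _
  have hlt : (P.biUnion bad).card < Ω.card := by
    calc (P.biUnion bad).card ≤ ∑ a ∈ P, (bad a).card := card_biUnion_le
      _ ≤ ∑ a ∈ P, (B.card - g) ^ t := sum_le_sum hbad
      _ = P.card * (B.card - g) ^ t := by rw [sum_const, smul_eq_mul]
      _ < B.card ^ t := card_mul_pow_sub_lt_pow _ _ _ _ hg hgb hb hN
      _ = Ω.card := hΩcard.symm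
  obtain ⟨f, hfΩ, hfbad⟩ := exists_mem_notMem_of_card_lt_card hlt
  have hfB : ∀ i, f i ∈ B := fun i => Fintype.mem_piFinset.1 hfΩ i
  refine ⟨univ.image f, ?_, ?_, ?_⟩
  · intro X hX
    obtain ⟨i, -, rfl⟩ := mem_image.1 hX
    exact hfB i
  · exact card_image_le.trans (by simp)
  · intro a ha
    have hnot : f ∉ bad a := fun h => hfbad (mem_biUnion.2 ⟨a, ha, h⟩)
    rw [hbad_def, Fintype.mem_piFinset] at hnot
    push Not at hnot
    obtain ⟨i, hi⟩ := hnot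
    refine ⟨f i, mem_image.2 ⟨i, mem_univ _, rfl⟩, ?_⟩
    by_contra hno
    exact hi (mem_sdiff.2 ⟨hfB i, hno⟩)

/-- The number of perfect matchings of `K_{2m}` is (crudely) less than `2^{m(2m+1)+1}` (they are edge
subsets, and `|E(K_{2m})| + 2m = C(2m+1, 2) = m(2m+1)`). [folklore] -/
private theorem card_perfectMatchings_lt_two_pow (m : ℕ) :
    (perfectMatchings (Finset.univ : Finset (Fin (2 * m)))).card < 2 ^ (m * (2 * m + 1) + 1) := by
  have hsub : perfectMatchings (Finset.univ : Finset (Fin (2 * m))) ⊆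
      (Finset.univ : Finset (Fin (2 * m))).sym2.powerset := filter_subset _ _
  have hsym : ((Finset.univ : Finset (Fin (2 * m))).sym2).card = m * (2 * m + 1) := by
    rw [card_sym2, card_univ, Fintype.card_fin, Nat.choose_two_right]
    rw [show (2 * m + 1) * (2 * m + 1 - 1) = 2 * (m * (2 * m + 1)) by
      rw [Nat.add_sub_cancel]; ring]
    exact Nat.mul_div_cancel_left _ (by norm_num)
  calc (perfectMatchings (Finset.univ : Finset (Fin (2 * m)))).card
        ≤ ((Finset.univ : Finset (Fin (2 * m))).sym2.powerset).card := card_le_card hsub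
    _ = 2 ^ (m * (2 * m + 1)) := by rw [card_powerset, hsym]
    _ < 2 ^ (m * (2 * m + 1) + 1) := Nat.pow_lt_pow_right (by norm_num) (by omega)

/-- **Faenza–Fiorini–Grappe–Tiwary, Lemma 12 (compatible cover), with the explicit count
`k ≤ 2^m · (m(2m+1)+1)` for `n = 2m`:** there is a family `𝒳` of at most that many `m`-subsets of
`[2m]` such that every perfect matching of `K_{2m}` is compatible with some `X ∈ 𝒳`.  (Printed:
`k = O(2^{n/2}√n ln n)`; see the module docstring's TODO.)
[cite: FaenzaFioriniGrappeTiwary2015, Lemma 12 (Appendix; arXiv p. 14)] -/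
theorem exists_compatible_cover (m : ℕ) :
    ∃ 𝒳 : Finset (Finset (Fin (2 * m))), 𝒳.card ≤ 2 ^ m * (m * (2 * m + 1) + 1) ∧
      (∀ X ∈ 𝒳, X.card = m) ∧
      ∀ M : Finset (Sym2 (Fin (2 * m))), IsPMOn Finset.univ M → ∃ X ∈ 𝒳, IsCompatible X M := by
  classical
  set P := perfectMatchings (Finset.univ : Finset (Fin (2 * m))) with hP
  set B := (Finset.univ : Finset (Fin (2 * m))).powersetCard m with hB
  set good : Finset (Sym2 (Fin (2 * m))) → Finset (Finset (Fin (2 * m))) :=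
    fun M => B.filter fun X => IsCompatible X M with hgood
  -- matchings in `P` have `m` edges
  have hMcard : ∀ M ∈ P, M.card = m := fun M hM => by
    have h := (mem_perfectMatchings.1 hM).two_mul_card_eq
    omega
  -- every matching is good for `≥ 2^m` members of `B`
  have hgoodcard : ∀ M ∈ P, 2 ^ m ≤ (good M).card := fun M hM => by
    have hpm : IsPMOn Finset.univ M := mem_perfectMatchings.1 hM
    have h := MatchingBipartiteCover.two_pow_card_le_card_filter hpm B fun T _ => by
      rw [hB, mem_powersetCard]
      exact ⟨subset_univ _, by rw [MatchingBipartiteCover.card_side hpm T, hMcard M hM]⟩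
    rwa [hMcard M hM] at h
  -- `2^m ≤ |B| ≤ 2^m · 2^m`
  have hBle : B.card ≤ 2 ^ m * 2 ^ m := by
    calc B.card ≤ ((Finset.univ : Finset (Fin (2 * m))).powerset).card :=
          card_le_card fun X hX => mem_powerset.2 (mem_powersetCard.1 hX).1
      _ = 2 ^ m * 2 ^ m := by rw [card_powerset, card_univ, Fintype.card_fin, two_mul, pow_add]
  have hgB : 2 ^ m ≤ B.card := by
    obtain ⟨M₀, hM₀⟩ := perfectMatchings_nonempty (S := (Finset.univ : Finset (Fin (2 * m))))
      (by rw [card_univ, Fintype.card_fin]; exact even_two_mul m)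
    exact (hgoodcard M₀ hM₀).trans (card_le_card (filter_subset _ _))
  obtain ⟨𝒳, h𝒳B, hcard, hhit⟩ := exists_hitting_family P B good (fun _ _ => filter_subset _ _)
    (2 ^ m) (m * (2 * m + 1) + 1) Nat.one_le_two_pow hgB hBle hgoodcard
    (card_perfectMatchings_lt_two_pow m)
  refine ⟨𝒳, hcard, fun X hX => (mem_powersetCard.1 (h𝒳B hX)).2, fun M hM => ?_⟩
  obtain ⟨X, hX, hXg⟩ := hhit M (mem_perfectMatchings.2 hM)
  exact ⟨X, hX, (mem_filter.1 hXg).2⟩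

/-- **Faenza–Fiorini–Grappe–Tiwary 2015, Lemma 12** ("Let `n` be an even positive integer. There exists a
collection of `k` subsets `X_1, …, X_k` of size `n/2` of `[n]` such that for every perfect matching `M`
of `K^n` at least one of the subsets `X_i` is compatible with `M`"), with `k ≤ 2^{n/2} · n²` in place of
the printed `k = O(2^{n/2} √n ln n)`. [cite: FaenzaFioriniGrappeTiwary2015, Lemma 12 (Appendix; arXiv p. 14)] -/
theorem FaenzaFioriniGrappeTiwary2015_lemma12 {n : ℕ} (hn : Even n) (h2 : 2 ≤ n) :
    ∃ 𝒳 : Finset (Finset (Fin n)), 𝒳.card ≤ 2 ^ (n / 2) * n ^ 2 ∧ (∀ X ∈ 𝒳, X.card = n / 2) ∧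
      ∀ M : Finset (Sym2 (Fin n)), IsPMOn Finset.univ M → ∃ X ∈ 𝒳, IsCompatible X M := by
  obtain ⟨m, rfl⟩ := hn
  have hm : 1 ≤ m := by omega
  rw [← two_mul] at h2 ⊢
  obtain ⟨𝒳, hcard, hbal, hcov⟩ := exists_compatible_cover m
  have hdiv : 2 * m / 2 = m := by omega
  refine ⟨𝒳, hcard.trans ?_, by rwa [hdiv], hcov⟩
  rw [hdiv]
  refine Nat.mul_le_mul_left _ ?_
  nlinarith

/-! ### The bipartite pieces: Birkhoff–von Neumann, transported into `ℝ^{E(K_n)}` -/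

/-- The generators of the piece of `X`: characteristic vectors of the perfect matchings of `K_n` compatible
with `X` (= the perfect matchings of the complete bipartite graph `K_{X, X̄}`).
[cite: FaenzaFioriniGrappeTiwary2015, §3 before Example 3 (arXiv p. 9)] -/
def bipGens (X : Finset (Fin n)) : Set ((⊤ : SimpleGraph (Fin n)).edgeSet → ℝ) :=
  {x | ∃ M : Finset (Sym2 (Fin n)), IsPMOn Finset.univ M ∧ IsCompatible X M ∧ x = charVec M}

namespace MatchingBipartiteCover

variable {X : Finset (Fin n)} (φ : ↥X ≃ ↥(Xᶜ))

/-- The crossing edge `{i, φ(j)}` (`i, j ∈ X`, `φ : X ≃ X̄`) — the coordinate embedding along which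
Birkhoff's theorem is transported. [folklore] -/
def crossEdge (p : ↥X × ↥X) : Sym2 (Fin n) :=
  s(((p.1 : ↥X) : Fin n), ((φ p.2 : ↥(Xᶜ)) : Fin n))

/-- Crossing edges are not loops. [folklore] -/
private theorem crossEdge_not_isDiag (p : ↥X × ↥X) : ¬(crossEdge φ p).IsDiag := by
  rw [crossEdge, Sym2.mk_isDiag_iff]
  intro h
  have h1 : ((p.1 : ↥X) : Fin n) ∈ X := p.1.2
  have h2 : ((φ p.2 : ↥(Xᶜ)) : Fin n) ∈ Xᶜ := (φ p.2).2
  rw [h] at h1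
  exact (mem_compl.1 h2) h1

/-- `(i, j) ↦ {i, φ(j)}` is injective. [folklore] -/
private theorem crossEdge_injective : Function.Injective (crossEdge φ) := by
  intro p q h
  rw [crossEdge, crossEdge, Sym2.eq_iff] at h
  rcases h with ⟨h1, h2⟩ | ⟨h1, h2⟩
  · exact Prod.ext (Subtype.ext h1) (φ.injective (Subtype.ext h2))
  · exfalso
    have : ((p.1 : ↥X) : Fin n) ∈ Xᶜ := h1 ▸ (φ q.2).2
    exact (mem_compl.1 this) p.1.2

/-- A crossing edge has exactly one endpoint in `X`. [folklore] -/
private theorem cutCount_crossEdge (p : ↥X × ↥X) : cutCount X (crossEdge φ p) = 1 := by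
  rw [crossEdge, cutCount_mk, if_pos p.1.2, if_neg (mem_compl.1 (φ p.2).2)]

/-- Every pair with exactly one endpoint in `X` is a crossing edge `{i, φ(j)}`. [folklore] -/
private theorem exists_eq_crossEdge {e : Sym2 (Fin n)} (he : cutCount X e = 1) :
    ∃ p : ↥X × ↥X, e = crossEdge φ p := by
  induction e using Sym2.ind with
  | h a b =>
    rw [cutCount_mk] at he
    by_cases ha : a ∈ X
    · have hb : b ∉ X := by
        intro hb
        rw [if_pos ha, if_pos hb] at he
        omega
      refine ⟨(⟨a, ha⟩, φ.symm ⟨b, mem_compl.2 hb⟩), ?_⟩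
      simp [crossEdge]
    · have hb : b ∈ X := by
        by_contra hb
        rw [if_neg ha, if_neg hb] at he
        omega
      refine ⟨(⟨b, hb⟩, φ.symm ⟨a, mem_compl.2 ha⟩), ?_⟩
      simp [crossEdge, Sym2.eq_swap]

/-- A vertex of `X` on the crossing edge `{i, φ(j)}` is `i`. [folklore] -/
private theorem eq_fst_of_mem_crossEdge {p : ↥X × ↥X} {i : ↥X} (h : (i : Fin n) ∈ crossEdge φ p) :
    i = p.1 := by
  rw [crossEdge, Sym2.mem_iff] at h
  rcases h with h | h
  · exact Subtype.ext h
  · exfalso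
    have : ((i : ↥X) : Fin n) ∈ Xᶜ := h ▸ (φ p.2).2
    exact (mem_compl.1 this) i.2

/-- A vertex of `X̄` on the crossing edge `{i, φ(j)}` is `φ(j)`. [folklore] -/
private theorem eq_snd_of_mem_crossEdge {p : ↥X × ↥X} {j : ↥X} (h : ((φ j : ↥(Xᶜ)) : Fin n) ∈ crossEdge φ p) :
    j = p.2 := by
  rw [crossEdge, Sym2.mem_iff] at h
  rcases h with h | h
  · exfalso
    have : ((φ j : ↥(Xᶜ)) : Fin n) ∈ X := h ▸ p.1.2
    exact (mem_compl.1 (φ j).2) this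
  · exact φ.injective (Subtype.ext h)

/-- The coordinate embedding `A`: `(A y)_e = y_{ij}` if `e = {i, φ(j)}` is crossing, `0` otherwise.
[folklore] -/
def bipA : Matrix ((⊤ : SimpleGraph (Fin n)).edgeSet) (↥X × ↥X) ℝ :=
  fun ε p => if (ε : Sym2 (Fin n)) = crossEdge φ p then 1 else 0

/-- The equation matrix `B`: row sums (`Sum.inl i`) and column sums (`Sum.inr j`) of `y`. [folklore] -/
def bipB (X : Finset (Fin n)) : Matrix (↥X ⊕ ↥X) (↥X × ↥X) ℝ :=
  fun r p => Sum.elim (fun i : ↥X => if p.1 = i then (1 : ℝ) else 0)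
    (fun j : ↥X => if p.2 = j then (1 : ℝ) else 0) r

/-- `A y` on a crossing coordinate. [folklore] -/
private theorem bipA_mulVec_of_eq (y : ↥X × ↥X → ℝ) {ε : (⊤ : SimpleGraph (Fin n)).edgeSet} {p : ↥X × ↥X}
    (h : (ε : Sym2 (Fin n)) = crossEdge φ p) : (bipA φ *ᵥ y) ε = y p := by
  simp only [mulVec, dotProduct, bipA]
  rw [Finset.sum_eq_single p]
  · rw [if_pos h, one_mul]
  · intro q _ hq
    rw [if_neg, zero_mul]
    intro h'
    exact hq (crossEdge_injective φ (h'.symm.trans h))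
  · intro hp
    exact absurd (mem_univ p) hp

/-- `A y` vanishes off the crossing coordinates. [folklore] -/
private theorem bipA_mulVec_of_ne (y : ↥X × ↥X → ℝ) {ε : (⊤ : SimpleGraph (Fin n)).edgeSet}
    (h : ∀ p, (ε : Sym2 (Fin n)) ≠ crossEdge φ p) : (bipA φ *ᵥ y) ε = 0 := by
  simp only [mulVec, dotProduct, bipA]
  exact Finset.sum_eq_zero fun p _ => by rw [if_neg (h p), zero_mul]

/-- `B y` at a row index is a row sum. [folklore] -/
private theorem bipB_mulVec_inl (y : ↥X × ↥X → ℝ) (i : ↥X) :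
    (bipB X *ᵥ y) (Sum.inl i) = ∑ j, y (i, j) := by
  simp only [mulVec, dotProduct, bipB, Sum.elim_inl]
  rw [Fintype.sum_prod_type, Finset.sum_eq_single i]
  · simp
  · intro a _ ha
    simp [ha]
  · intro hi
    exact absurd (mem_univ i) hi

/-- `B y` at a column index is a column sum. [folklore] -/
private theorem bipB_mulVec_inr (y : ↥X × ↥X → ℝ) (j : ↥X) :
    (bipB X *ᵥ y) (Sum.inr j) = ∑ i, y (i, j) := by
  simp only [mulVec, dotProduct, bipB, Sum.elim_inr]
  rw [Fintype.sum_prod_type]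
  refine Finset.sum_congr rfl fun a _ => ?_
  rw [Finset.sum_eq_single j]
  · simp
  · intro b _ hb
    simp [hb]
  · intro hj
    exact absurd (mem_univ j) hj

/-- A sum of indicators with a unique witness is `1`. [folklore] -/
private theorem sum_ite_eq_one_of_iff {ι : Type*} [Fintype ι] [DecidableEq ι] (P : ι → Prop)
    [DecidablePred P] (j₀ : ι) (h : ∀ j, P j ↔ j = j₀) :
    (∑ j, if P j then (1 : ℝ) else 0) = 1 := by
  have hc : ∀ j ∈ (univ : Finset ι), (if P j then (1 : ℝ) else 0) = if j = j₀ then 1 else 0 :=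
    fun j _ => by
      by_cases hj : j = j₀
      · rw [if_pos hj, if_pos ((h j).2 hj)]
      · rw [if_neg hj, if_neg fun hP => hj ((h j).1 hP)]
  rw [Finset.sum_congr rfl hc]
  simp

/-- **The easy inclusion**: the characteristic vector of a perfect matching compatible with `X` is
`A y` for the `0/1` doubly stochastic (= permutation) matrix `y_{ij} = [{i, φ(j)} ∈ M]` ("Integral doubly
stochastic matrices are called permutation matrices").
[cite: KorteVygen2018, Thm. 11.4 and Cor. 11.5 (§11.1; held scan p. 265)] -/
theorem charVec_mem_pointedSet {M : Finset (Sym2 (Fin n))} (hM : IsPMOn Finset.univ M)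
    (hc : IsCompatible X M) : charVec M ∈ pointedSet 0 (bipA φ) (bipB X) 1 := by
  classical
  set y : ↥X × ↥X → ℝ := fun p => if crossEdge φ p ∈ M then 1 else 0 with hy
  have hy0 : ∀ p, 0 ≤ y p := fun p => by
    simp only [hy]
    split_ifs <;> norm_num
  refine ⟨y, hy0, ?_, ?_⟩
  · funext r
    rcases r with i | j
    · -- row `i`: the unique edge of `M` at `i` is `{i, φ(j₀)}`
      rw [bipB_mulVec_inl, Pi.one_apply]
      obtain ⟨e, he, hie⟩ := hM.exists_mem (mem_univ (i : Fin n))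
      obtain ⟨p, hp⟩ := exists_eq_crossEdge φ (hc e he)
      have hi : i = p.1 := eq_fst_of_mem_crossEdge φ (hp ▸ hie)
      refine sum_ite_eq_one_of_iff _ p.2 fun j => ⟨fun hj => ?_, fun hj => ?_⟩
      · have hmem : (i : Fin n) ∈ crossEdge φ (i, j) := by simp [crossEdge]
        have := hM.unique hj he hmem hie
        rw [hp] at this
        exact congrArg Prod.snd (crossEdge_injective φ this)
      · rw [hj, hi, Prod.mk.eta, ← hp]
        exact he
    · -- column `j`: the unique edge of `M` at `φ(j)` is `{i₀, φ(j)}`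
      rw [bipB_mulVec_inr, Pi.one_apply]
      obtain ⟨e, he, hje⟩ := hM.exists_mem (mem_univ ((φ j : ↥(Xᶜ)) : Fin n))
      obtain ⟨p, hp⟩ := exists_eq_crossEdge φ (hc e he)
      have hj : j = p.2 := eq_snd_of_mem_crossEdge φ (hp ▸ hje)
      refine sum_ite_eq_one_of_iff (fun i => crossEdge φ (i, j) ∈ M) p.1 fun i =>
        ⟨fun hi => ?_, fun hi => ?_⟩
      · have hmem : ((φ j : ↥(Xᶜ)) : Fin n) ∈ crossEdge φ (i, j) := by simp [crossEdge]
        have := hM.unique hi he hmem hje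
        rw [hp] at this
        exact congrArg Prod.fst (crossEdge_injective φ this)
      · rw [hi, hj, Prod.mk.eta, ← hp]
        exact he
  · rw [zero_add]
    funext ε
    by_cases hε : ∃ p, (ε : Sym2 (Fin n)) = crossEdge φ p
    · obtain ⟨p, hp⟩ := hε
      rw [bipA_mulVec_of_eq φ y hp]
      simp only [charVec, hy, hp]
    · push Not at hε
      rw [bipA_mulVec_of_ne φ y hε]
      simp only [charVec]
      rw [if_neg]
      intro hεM
      obtain ⟨p, hp⟩ := exists_eq_crossEdge φ (hc _ hεM)
      exact hε p hp

/-- The perfect matching `{ {i, φ(σ i)} : i ∈ X }` of a permutation `σ` of `X` (the image of the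
permutation matrix `P_σ` under `A`). [folklore] -/
def permPM (σ : Equiv.Perm ↥X) : Finset (Sym2 (Fin n)) :=
  univ.image fun i : ↥X => crossEdge φ (i, σ i)

/-- `permPM σ` is a perfect matching of `K_n` (every vertex of `X` and of `X̄ = φ(X)` is on exactly one of
its edges). [folklore] -/
private theorem permPM_isPMOn (σ : Equiv.Perm ↥X) : IsPMOn Finset.univ (permPM φ σ) := by
  classical
  refine ⟨fun e _ => mem_sym2_iff.2 fun a _ => mem_univ a, fun e he => ?_, fun v _ => ?_⟩
  · obtain ⟨i, -, rfl⟩ := mem_image.1 he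
    exact crossEdge_not_isDiag φ _
  · rw [card_eq_one]
    by_cases hv : v ∈ X
    · -- `v = i₀ ∈ X`: its edge is `{i₀, φ(σ i₀)}`
      set i₀ : ↥X := ⟨v, hv⟩
      refine ⟨crossEdge φ (i₀, σ i₀), ?_⟩
      ext e
      simp only [permPM, mem_filter, mem_image, mem_univ, true_and, mem_singleton]
      constructor
      · rintro ⟨⟨i, rfl⟩, hve⟩
        have : i₀ = (i, σ i).1 := eq_fst_of_mem_crossEdge φ (i := i₀) hve
        rw [this]
      · rintro rfl
        exact ⟨⟨i₀, rfl⟩, by simp [crossEdge, i₀]⟩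
    · -- `v = φ(j₀) ∈ X̄`: its edge is `{σ⁻¹ j₀, φ(j₀)}`
      set j₀ : ↥X := φ.symm ⟨v, mem_compl.2 hv⟩
      have hvj : v = ((φ j₀ : ↥(Xᶜ)) : Fin n) := by simp [j₀]
      refine ⟨crossEdge φ (σ.symm j₀, σ (σ.symm j₀)), ?_⟩
      ext e
      simp only [permPM, mem_filter, mem_image, mem_univ, true_and, mem_singleton]
      constructor
      · rintro ⟨⟨i, rfl⟩, hve⟩
        rw [hvj] at hve
        have hj : j₀ = (i, σ i).2 := eq_snd_of_mem_crossEdge φ hve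
        simp only at hj
        rw [hj, Equiv.symm_apply_apply]
      · rintro rfl
        refine ⟨⟨σ.symm j₀, rfl⟩, ?_⟩
        rw [hvj, Equiv.apply_symm_apply]
        simp [crossEdge]

/-- `permPM σ` is compatible with `X`. [folklore] -/
private theorem permPM_compatible (σ : Equiv.Perm ↥X) : IsCompatible X (permPM φ σ) := by
  intro e he
  obtain ⟨i, -, rfl⟩ := mem_image.1 he
  exact cutCount_crossEdge φ _

/-- `A` maps the permutation matrix of `σ` to the characteristic vector of `permPM σ`. [folklore] -/
private theorem bipA_mulVec_perm (σ : Equiv.Perm ↥X) :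
    bipA φ *ᵥ (fun p : ↥X × ↥X => if σ p.1 = p.2 then (1 : ℝ) else 0) = charVec (permPM φ σ) := by
  classical
  funext ε
  by_cases hε : ∃ p, (ε : Sym2 (Fin n)) = crossEdge φ p
  · obtain ⟨p, hp⟩ := hε
    rw [bipA_mulVec_of_eq φ _ hp]
    have hiff : σ p.1 = p.2 ↔ (ε : Sym2 (Fin n)) ∈ permPM φ σ := by
      rw [hp, permPM, mem_image]
      constructor
      · intro h
        exact ⟨p.1, mem_univ _, by rw [h]⟩
      · rintro ⟨i, -, hi⟩
        have := crossEdge_injective φ hi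
        rw [← this]
    simp only [charVec]
    by_cases h : σ p.1 = p.2
    · rw [if_pos h, if_pos (hiff.1 h)]
    · rw [if_neg h, if_neg (fun h' => h (hiff.2 h'))]
  · push Not at hε
    rw [bipA_mulVec_of_ne φ _ hε]
    simp only [charVec]
    rw [if_neg]
    intro hmem
    obtain ⟨i, -, hi⟩ := mem_image.1 hmem
    exact hε _ hi.symm

/-- Entries of a permutation matrix: `(P_σ)_{ij} = [σ i = j]`. [folklore] -/
private theorem permMatrix_apply_eq_ite (σ : Equiv.Perm ↥X) (i j : ↥X) :
    σ.permMatrix ℝ i j = if σ i = j then 1 else 0 := by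
  rw [Equiv.Perm.permMatrix, PEquiv.toMatrix_apply, Equiv.toPEquiv_apply]
  have hiff : j ∈ some (σ i) ↔ σ i = j :=
    ⟨fun h' => Option.some.inj (Option.mem_def.1 h'), fun h' => Option.mem_def.2 (congrArg some h')⟩
  by_cases h : σ i = j
  · rw [if_pos h, if_pos (hiff.2 h)]
  · rw [if_neg h, if_neg fun h' => h (hiff.1 h')]

/-- **The Birkhoff–von Neumann inclusion** ("Any doubly stochastic matrix `M` can be written as a convex
combination of permutation matrices"; "For `e = {a_i, b_j} ∈ E(K_{n,n})` let `x_e = m_{ij}`"): every `A y`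
with `y ≥ 0` doubly stochastic is a convex combination of characteristic vectors of perfect matchings
compatible with `X` (Mathlib's `exists_eq_sum_perm_of_mem_doublyStochastic`, pushed through the linear
map `A`). [cite: KorteVygen2018, Cor. 11.5 (§11.1; held scan p. 265)] -/
theorem pointedSet_subset_convexHull :
    pointedSet 0 (bipA φ) (bipB X) 1 ⊆ convexHull ℝ (bipGens X) := by
  classical
  rintro x ⟨y, hy, hBy, rfl⟩
  rw [zero_add]
  have hY : (Matrix.of fun i j : ↥X => y (i, j)) ∈ doublyStochastic ℝ ↥X := by
    rw [mem_doublyStochastic_iff_sum]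
    refine ⟨fun i j => hy (i, j), fun i => ?_, fun j => ?_⟩
    · have h := congrFun hBy (Sum.inl i)
      rw [bipB_mulVec_inl, Pi.one_apply] at h
      simpa using h
    · have h := congrFun hBy (Sum.inr j)
      rw [bipB_mulVec_inr, Pi.one_apply] at h
      simpa using h
  obtain ⟨w, hw0, hw1, hwsum⟩ := exists_eq_sum_perm_of_mem_doublyStochastic hY
  have hy_eq : y = ∑ σ : Equiv.Perm ↥X,
      w σ • (fun p : ↥X × ↥X => if σ p.1 = p.2 then (1 : ℝ) else 0) := by
    funext p
    have h := congrFun (congrFun hwsum p.1) p.2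
    rw [Matrix.of_apply, Matrix.sum_apply] at h
    rw [← h, Finset.sum_apply]
    refine Finset.sum_congr rfl fun σ _ => ?_
    rw [Matrix.smul_apply, Pi.smul_apply, permMatrix_apply_eq_ite]
  have hsum : bipA φ *ᵥ y = ∑ σ : Equiv.Perm ↥X, w σ • charVec (permPM φ σ) := by
    rw [hy_eq, Matrix.mulVec_sum]
    refine Finset.sum_congr rfl fun σ _ => ?_
    rw [Matrix.mulVec_smul, bipA_mulVec_perm]
  rw [hsum]
  refine (convex_convexHull ℝ _).sum_mem (fun σ _ => hw0 σ) hw1 fun σ _ => ?_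
  exact subset_convexHull ℝ _ ⟨permPM φ σ, permPM_isPMOn φ σ, permPM_compatible φ σ, rfl⟩

/-- **The piece of a balanced `X` is a pointed formulation** (`conv{χ^M : M compatible with X}` =
`{A y : y ≥ 0, B y = 𝟙}`): the perfect matching polytope of the complete bipartite graph `K_{X,X̄}` is
its fractional perfect matching polytope `{x ≥ 0 : x(δ(v)) = 1}` ("If `G` is bipartite, then `P` and `Q`
are both integral"), i.e. the (embedded) Birkhoff polytope.
[cite: KorteVygen2018, Thm. 11.4 and Cor. 11.5 (§11.1; held scan p. 265)] -/
theorem convexHull_bipGens_eq_pointedSet :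
    convexHull ℝ (bipGens X) = pointedSet 0 (bipA φ) (bipB X) 1 :=
  Set.Subset.antisymm
    (convexHull_min (by
      rintro x ⟨M, hM, hc, rfl⟩
      exact charVec_mem_pointedSet φ hM hc) (convex_pointedSet _ _ _ _))
    (pointedSet_subset_convexHull φ)

end MatchingBipartiteCover

/-- **Each bipartite piece has a pointed extended formulation of size `|X|²`** (for `2|X| = n`): the
Birkhoff description of the perfect matching polytope of `K_{X,X̄}` by the `|X|·|X̄|` edge variables
`y ≥ 0` and the `2|X|` degree equations; the recession condition holds because `y ≥ 0` with zero row
sums is `0`. [cite: Rothvoss2017, §1 (PDF p. 4, L26–30: "complete bipartite graphs cover all matchings")] -/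
theorem hasPointedEFOfSize_convexHull_bipGens (X : Finset (Fin n)) (hX : 2 * X.card = n) :
    HasPointedEFOfSize (convexHull ℝ (bipGens X)) (X.card ^ 2) := by
  classical
  have hc : Fintype.card ↥X = Fintype.card ↥(Xᶜ) := by
    rw [Fintype.card_coe, Fintype.card_coe, card_compl, Fintype.card_fin]
    omega
  set φ : ↥X ≃ ↥(Xᶜ) := Fintype.equivOfCardEq hc
  refine ⟨↥X × ↥X, ↥X ⊕ ↥X, inferInstance, inferInstance, 0, MatchingBipartiteCover.bipA φ,
    MatchingBipartiteCover.bipB X, 1, by simp [Fintype.card_coe, sq], ?_,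
    MatchingBipartiteCover.convexHull_bipGens_eq_pointedSet φ⟩
  intro y hy hB
  have hy0 : y = 0 := by
    funext p
    have h := congrFun hB (Sum.inl p.1)
    rw [MatchingBipartiteCover.bipB_mulVec_inl, Pi.zero_apply] at h
    exact (sum_eq_zero_iff_of_nonneg fun j _ => hy (p.1, j)).1 h p.2 (mem_univ _)
  rw [hy0, mulVec_zero]

/-! ### Balas over the cover -/

/-- The empty set has a pointed formulation of size `0` (an infeasible equation `0 = 1`). [folklore] -/
private theorem hasPointedEFOfSize_empty {ι : Type} : HasPointedEFOfSize (∅ : Set (ι → ℝ)) 0 := by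
  refine ⟨Fin 0, Fin 1, inferInstance, inferInstance, 0, 0, 0, 1, by simp, fun y _ _ => by
    rw [zero_mulVec], ?_⟩
  ext x
  simp only [pointedSet, Set.mem_empty_iff_false, Set.mem_setOf_eq, false_iff]
  rintro ⟨y, -, hB, -⟩
  have h := congrFun hB 0
  rw [zero_mulVec, Pi.zero_apply, Pi.one_apply] at h
  exact zero_ne_one h

/-- **Balas' union bound iterated over the cover**: if each of the `k` pieces has a pointed formulation
of size `c`, the convex hull of the union of their generators has one of size `k·(c+2)`
(`xc(P ⊔ Q) ≤ xc(P) + xc(Q) + 2`, tree theorem `HasPointedEFOfSize.convexHull_union`).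
[cite: HrubesYehudayoff2021, Lemma 34] [cite: Rothvoss2017, §1 (PDF p. 4, L28–30: "the convex hull of the union of polytopes can be described with a few extra inequalities")] -/
theorem hasPointedEFOfSize_convexHull_biUnion (𝒳 : Finset (Finset (Fin n))) (c : ℕ)
    (h : ∀ X ∈ 𝒳, HasPointedEFOfSize (convexHull ℝ (bipGens X)) c) :
    HasPointedEFOfSize (convexHull ℝ (⋃ X ∈ 𝒳, bipGens X)) (𝒳.card * (c + 2)) := by
  classical
  induction 𝒳 using Finset.induction_on with
  | empty => simpa using (hasPointedEFOfSize_empty (ι := (⊤ : SimpleGraph (Fin n)).edgeSet))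
  | insert X 𝒳 hX ih =>
    have h1 := h X (mem_insert_self _ _)
    have h2 := ih fun Y hY => h Y (mem_insert_of_mem hY)
    have h3 := HasPointedEFOfSize.convexHull_union h1 h2
    rw [convexHull_convexHull_union_left, convexHull_convexHull_union_right] at h3
    rw [set_biUnion_insert, card_insert_of_notMem hX]
    convert h3 using 1
    ring

/-- **A compatible cover exhibits `P_PM(K_n)` as the convex hull of the union of its bipartite pieces**
("every perfect matching of `K^n` is a perfect matching of at least one of the `G_i`'s").
[cite: FaenzaFioriniGrappeTiwary2015, §3 before Example 3 (arXiv p. 9)] -/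
theorem pmPolytope_eq_convexHull_biUnion {𝒳 : Finset (Finset (Fin n))}
    (hcov : ∀ M : Finset (Sym2 (Fin n)), IsPMOn Finset.univ M → ∃ X ∈ 𝒳, IsCompatible X M) :
    pmPolytope n = convexHull ℝ (⋃ X ∈ 𝒳, bipGens X) := by
  unfold pmPolytope
  congr 1
  ext x
  simp only [Set.mem_setOf_eq, Set.mem_iUnion, bipGens, exists_prop]
  constructor
  · rintro ⟨M, hM, rfl⟩
    obtain ⟨X, hX, hc⟩ := hcov M hM
    exact ⟨X, hX, M, hM, hc, rfl⟩
  · rintro ⟨X, -, M, hM, -, rfl⟩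
    exact ⟨M, hM, rfl⟩

/-! ### The bound -/

/-- **`xc(P_PM(K_{2m})) ≤ 2^m · (m(2m+1)+1) · (m²+2)`**: Balas over a compatible cover by
`k ≤ 2^m(m(2m+1)+1)` balanced bipartite pieces of Birkhoff size `m²` each.
[cite: Rothvoss2017, §1 (PDF p. 4, L26–30)] [cite: FaenzaFioriniGrappeTiwary2015, Example 3 (§3, arXiv p. 9) and Lemma 12 (arXiv p. 14)] -/
theorem hasEFOfSize_pmPolytope_bipartiteCover (m : ℕ) :
    HasEFOfSize (pmPolytope (2 * m)) (2 ^ m * (m * (2 * m + 1) + 1) * (m ^ 2 + 2)) := by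
  obtain ⟨𝒳, hcard, hbal, hcov⟩ := exists_compatible_cover m
  have hp := hasPointedEFOfSize_convexHull_biUnion 𝒳 (m ^ 2) fun X hX => by
    have h := hasPointedEFOfSize_convexHull_bipGens X (by rw [hbal X hX])
    rwa [hbal X hX] at h
  rw [← pmPolytope_eq_convexHull_biUnion hcov] at hp
  exact hp.hasEFOfSize.of_le (Nat.mul_le_mul_right _ hcard)

/-- Polynomial bookkeeping: `(m(2m+1)+1)(m²+2) ≤ (2m)⁴` for `m ≥ 1`. [folklore] -/
private theorem poly_le_pow_four (m : ℕ) (hm : 1 ≤ m) :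
    (m * (2 * m + 1) + 1) * (m ^ 2 + 2) ≤ (2 * m) ^ 4 := by
  have h1 : 1 ≤ m ^ 4 := Nat.one_le_pow _ _ hm
  have h2 : m ≤ m ^ 4 := by
    calc m = m ^ 1 := (pow_one m).symm
      _ ≤ m ^ 4 := Nat.pow_le_pow_right hm (by norm_num)
  have h3 : m ^ 2 ≤ m ^ 4 := Nat.pow_le_pow_right hm (by norm_num)
  have h4 : m ^ 3 ≤ m ^ 4 := Nat.pow_le_pow_right hm (by norm_num)
  have hexp : (m * (2 * m + 1) + 1) * (m ^ 2 + 2) = 2 * m ^ 4 + m ^ 3 + 5 * m ^ 2 + 2 * m + 2 := by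
    ring
  rw [hexp]
  calc 2 * m ^ 4 + m ^ 3 + 5 * m ^ 2 + 2 * m + 2
      ≤ 2 * m ^ 4 + m ^ 4 + 5 * m ^ 4 + 2 * m ^ 4 + 2 * m ^ 4 := by omega
    _ = 12 * m ^ 4 := by ring
    _ ≤ 16 * m ^ 4 := by omega
    _ = (2 * m) ^ 4 := by ring

/-- **`xc(P_PM(K_n)) ≤ n⁴ · 2^{n/2}` for every even `n ≥ 2`** — the "`poly(n) · 2^{n/2}`" upper bound
on the extension complexity of the perfect matching polytope.
[cite: Rothvoss2017, §1 (PDF p. 4, L26–27)] [cite: FaenzaFioriniGrappeTiwary2015, Example 3 (§3, arXiv p. 9)] -/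
theorem hasEFOfSize_pmPolytope_halfExp {n : ℕ} (hn : Even n) (h2 : 2 ≤ n) :
    HasEFOfSize (pmPolytope n) (n ^ 4 * 2 ^ (n / 2)) := by
  obtain ⟨m, rfl⟩ := hn
  have hm : 1 ≤ m := by omega
  rw [← two_mul] at h2 ⊢
  have h := hasEFOfSize_pmPolytope_bipartiteCover m
  refine h.of_le ?_
  rw [show 2 * m / 2 = m by omega]
  calc 2 ^ m * (m * (2 * m + 1) + 1) * (m ^ 2 + 2)
      = 2 ^ m * ((m * (2 * m + 1) + 1) * (m ^ 2 + 2)) := by ring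
    _ ≤ 2 ^ m * (2 * m) ^ 4 := Nat.mul_le_mul_left _ (poly_le_pow_four m hm)
    _ = (2 * m) ^ 4 * 2 ^ m := by ring

/-- **`xc(P_PM(K_n)) = 2^{Θ(n)}`, with the exponent window `[c·n, n/2 + 4 log₂ n]`**: Rothvoß's
Theorem 1 (tree theorem `Rothvoss2017_thm1`: `∃ c > 0`, eventually on even `n` every EF of `P_PM(K_n)` has
size `≥ 2^{cn}`) together with the `n⁴ · 2^{n/2}` upper bound — sharpening the trivial `2^{n+1}` of
`Rothvoss2017_thm1_theta`. [cite: Rothvoss2017, Thm. 1 (PDF p. 4) and §1 (PDF p. 4, L26–27)] -/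
theorem Rothvoss2017_thm1_theta_halfExp :
    (∃ c : ℝ, 0 < c ∧ ∀ᶠ n : ℕ in atTop, Even n → ∀ r : ℕ, HasEFOfSize (pmPolytope n) r →
      (2 : ℝ) ^ (c * n) ≤ r) ∧
    ∀ n : ℕ, Even n → 2 ≤ n → HasEFOfSize (pmPolytope n) (n ^ 4 * 2 ^ (n / 2)) :=
  ⟨Rothvoss2017_thm1, fun _ hn h2 => hasEFOfSize_pmPolytope_halfExp hn h2⟩

/-- Psd twin: `P_PM(K_n)` has a psd lift of size `n⁴ · 2^{n/2} + 1` (LP lifts are psd lifts, tree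
theorem `hasPsdLift_pmPolytope_of_hasEFOfSize`); the kernel window for psd lifts of `P_PM(K_n)` becomes
`[C(n,2) − n + 1, n⁴·2^{n/2} + 1]`. [cite: Rothvoss2017, §1 (PDF p. 4, L26–27)] -/
theorem hasPsdLift_pmPolytope_halfExp {n : ℕ} (hn : Even n) (h2 : 2 ≤ n) :
    Literature.Combinatorics.Optimization.HasPsdLift (pmPolytope n) (n ^ 4 * 2 ^ (n / 2) + 1) :=
  hasPsdLift_pmPolytope_of_hasEFOfSize (hasEFOfSize_pmPolytope_halfExp hn h2)

/-! ### Slack-matrix reading (appended): `rk_psd(S_n) ≤ rk₊(S_n) ≤ n⁴ · 2^{n/2} + 1`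

Yannakakis' factorization theorem turns the `n⁴·2^{n/2}` extended formulation into a nonnegative —
hence psd — factorization of the slack matrices of `P_PM(K_n)` (tree theorems
`hasNonnegFactorization_pmOddCutSlack_of_hasEF`, `hasNonnegFactorization_pmFullSlack_of_hasEF`,
`hasPsdFactorization_pmOddCutSlack_of_hasPsdLift`, `hasPsdFactorization_pmFullSlack_of_hasPsdLift`), so
the cell's object, the odd-cut slack matrix `S_n(U, M) = |δ(U) ∩ M| − 1` (`pmOddCutSlack n`), now has the
kernel window `C(n/2+1, 2) − 1 ≤ rk_psd(S_n) ≤ n⁴·2^{n/2} + 1` (lower end: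
`MatchingSlackPsdFoolingSetSharp.lean`; previously the upper end was `2^{n+1} + 1`). -/

/-- **`rk₊(S_n) ≤ n⁴ · 2^{n/2} + 1`** for the odd-cut slack matrix of `P_PM(K_n)`, `n ≥ 2` even
(Yannakakis: an EF of size `r` gives a nonnegative factorization of the slack matrix of size `r + 1`).
[cite: Rothvoss2017, Thm. 4 (PDF p. 5) and §1 (PDF p. 4, L26–27)] -/
theorem hasNonnegFactorization_pmOddCutSlack_halfExp {n : ℕ} (hn : Even n) (h2 : 2 ≤ n) :
    Literature.Combinatorics.Optimization.HasNonnegFactorization (pmOddCutSlack n)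
      (n ^ 4 * 2 ^ (n / 2) + 1) :=
  hasNonnegFactorization_pmOddCutSlack_of_hasEF (hasEFOfSize_pmPolytope_halfExp hn h2)

/-- **`rk_psd(S_n) ≤ n⁴ · 2^{n/2} + 1`** for the odd-cut slack matrix of `P_PM(K_n)`, `n ≥ 2` even — the
upper end of the kernel window for the psd rank of the matching slack matrix (the open question being
whether it is polynomial). [cite: Rothvoss2017, §1 (PDF p. 4, L26–27)] [cite: FawziEtAl2015, Thm. 3.3 (p09)] -/
theorem hasPsdFactorization_pmOddCutSlack_halfExp {n : ℕ} (hn : Even n) (h2 : 2 ≤ n) :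
    Literature.Combinatorics.Optimization.HasPsdFactorization (pmOddCutSlack n)
      (n ^ 4 * 2 ^ (n / 2) + 1) :=
  hasPsdFactorization_pmOddCutSlack_of_hasPsdLift (by omega) (hasPsdLift_pmPolytope_halfExp hn h2)

/-- The same for Edmonds' FULL slack matrix (odd-cut and nonnegativity rows):
`rk₊(pmFullSlack n) ≤ n⁴ · 2^{n/2} + 1`. [cite: Rothvoss2017, Thm. 4 (PDF p. 5) and §1 (PDF p. 4, L26–27)] -/
theorem hasNonnegFactorization_pmFullSlack_halfExp {n : ℕ} (hn : Even n) (h2 : 2 ≤ n) :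
    Literature.Combinatorics.Optimization.HasNonnegFactorization
      (Literature.Combinatorics.Optimization.PMPolytopeDim.pmFullSlack n) (n ^ 4 * 2 ^ (n / 2) + 1) :=
  hasNonnegFactorization_pmFullSlack_of_hasEF (hasEFOfSize_pmPolytope_halfExp hn h2)

/-- The same for Edmonds' FULL slack matrix: `rk_psd(pmFullSlack n) ≤ n⁴ · 2^{n/2} + 1`.
[cite: Rothvoss2017, §1 (PDF p. 4, L26–27)] [cite: FawziEtAl2015, Thm. 3.3 (p09)] -/
theorem hasPsdFactorization_pmFullSlack_halfExp {n : ℕ} (hn : Even n) (h2 : 2 ≤ n) :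
    Literature.Combinatorics.Optimization.HasPsdFactorization
      (Literature.Combinatorics.Optimization.PMPolytopeDim.pmFullSlack n) (n ^ 4 * 2 ^ (n / 2) + 1) :=
  hasPsdFactorization_pmFullSlack_of_hasPsdLift (by omega) (hasPsdLift_pmPolytope_halfExp hn h2)

end Literature.Barriers.PneNP

end
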